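import Literature.NumberTheory.EllipticCurves.TorsionFilAtCyclicOfFrobeniusTraceProofs
import Literature.NumberTheory.EllipticCurves.TorsionFilAtCyclicOfOrdinaryPointProofs
import Literature.NumberTheory.EllipticCurves.TorsionFilAtCardProofs
import Literature.NumberTheory.EllipticCurves.HasseWeilAbelianInertiaInvariantsProofs
import HarnessLib

/-!
# An ordinary point at a place `v ∣ 3` of MULTIPLICATIVE reduction: some `3`-torsion point of `E(K̄_v)` lies outside the kernel of
# reduction `E₁(K̄_v)` (division polynomial `ψ₃ ≡ b₂x³ + b₈ (mod 𝔪_v)`, `b₂ ≢ 0`) — theorems only; no definition, no named fact,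
# no instance, no `sorry`

Topic `NumberTheory/EllipticCurves`.  Companion of `TorsionFilAtCyclicOfFrobeniusTraceProofs` (cell `pub/bsd-print-x9`, D1 road,
H.4 at `v ∣ p`), which produces the ordinary point «some `p`-torsion point of `E(K̄_v)` outside `E₁(K̄_v)`» at a place of GOOD
ORDINARY reduction from `p ∤ a_v` (Serre 1972 §1.11: `ψ_p²` of the reduction is non-constant, so it has an integral root, which carries
an integral `p`-torsion point).  Here the same conclusion at a place `v ∋ 3` of MULTIPLICATIVE reduction of `E/K` (`K` a number field),
for `p = 3`, where everything is explicit: the minimal model at `v` reduces to a NODAL cubic `Ẽ_v` (`Δ(Ẽ_v) = 0`, `c₄(Ẽ_v) ≠ 0`,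
Silverman AEC VII.5.1(b)); in characteristic `3`, `c₄ = b₂² − 24 b₄ = b₂²`, so `b₂(Ẽ_v) ≠ 0`, and Mathlib's third division polynomial
`Ψ₃ = 3x⁴ + b₂x³ + 3b₄x² + 3b₆x + b₈` reduces to `b₂x³ + b₈`, of degree `3`; hence `ΨSq₃ = Ψ₃²` of the reduction is non-constant,
the tree's root lifting (`exists_isRoot_of_natDegree_map_residue_ne_zero`) gives an integral root over the valuation ring of `K̄_v`,
and the integral point over it is a `3`-torsion point of `E(K̄_v)` NOT in `E₁(K̄_v)` (its abscissa is integral).  For the Tate curve this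
is the point `q^{1/3}` (Silverman ATAEC V.3); no uniformisation is used.

* `exists_integral_zsmul_eq_zero_of_natDegree_map_residue_ne_zero` — the integral `p`-torsion point of a Weierstrass equation `M` over a
  valuation ring `O ⊂ L` (`L` algebraically closed, `Δ(M) ≠ 0` in `L`; NO unit-discriminant hypothesis) from «`ΨSq_p(M) mod 𝔪` non-constant»
  — the construction of x9's `exists_zsmul_eq_zero_goodReductionHom_ne_zero` without the reduction homomorphism;
* `natDegree_ΨSq_three_ne_zero_of_b₂_ne_zero` — over a domain of characteristic `3` with `b₂ ≠ 0`, `ΨSq₃` has positive degree;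
* `reductionAt_b₂_ne_zero_of_hasMultiplicativeReductionAt_three` — `b₂(Ẽ_v) ≠ 0` at a multiplicative `v ∋ 3`;
* **`exists_ordinaryPoint_local_of_hasMultiplicativeReductionAt_three`** — the ordinary point in `E(K̄_v)`;
* **`exists_not_mem_torsionFilAt_of_hasMultiplicativeReductionAt_three`** — the same on `E(K̄)`: some `P ∈ E[3]` lies outside
  `Fil_v E[3] = torsionFilAt W v 3` (every `3`-torsion point of `E(K̄_v)` comes from `E(K̄)[3]`, tree `exists_geomTorsion_pointsMapOfEmb_eq`).
With `TorsionFilAtCyclicOfOrdinaryPointProofs` (cyclicity of `Fil_v E[p^k]` from one ordinary point, any place) this makes the Tate line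
`Fil_v E′[3^k]` of the twin `E′` of crux stmt-BirchSwinnertonDyer-24737 (multiplicative at `3 ∥ N′`) cyclic and isotropic — the `E`-level
input `hOrth` of Howard's H.4 at `v ∣ 3` (x9 `eisensteinTower_isSelfOrthogonalAt_of_mem`).

References: J.-P. Serre, Invent. Math. 15 (1972), §1.11 Prop. 11 [SerreInventiones1972]; J. H. Silverman, AEC (2009), III Ex. 3.7,
VII.2.1–2.2, VII.5.1(b) [SilvermanAEC2009]; J. H. Silverman, ATAEC (1994), V.3 (the Tate curve: `E[p] ∩ E₁ = μ_p`) [SilvermanATAEC1994].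
BSD is not proved by any of this.
-/

noncomputable section

open scoped NNReal Classical
open NumberField IsDedekindDomain Field Polynomial

namespace WeierstrassCurve

open Literature.NumberTheory.EllipticCurves Literature.NumberTheory.GaloisRepresentations
  IsDedekindDomain.HeightOneSpectrum AddSubgroup

universe u v

/-! ## §1 An integral `p`-torsion point from a non-constant reduction of `ΨSq_p` (no unit discriminant) -/

/-- **An integral `p`-torsion point.**  Let `O ⊂ L` be a valuation ring of an algebraically closed field and `M` a Weierstrass equation
over `O` whose discriminant is non-zero IN `L` (no unit hypothesis).  If the reduction of `ΨSq_p(M)` modulo the maximal ideal is not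
constant, then `M(L)` has a `p`-torsion point `(a, b)` with `a, b ∈ O` (root lifting twice: an integral root `a` of `ΨSq_p`, then an
integral root `b` of the monic quadratic `Y² + (a₁a + a₃)Y − (a³ + a₂a² + a₄a + a₆)`; `[p](a, b) = O` iff `ΨSq_p(a) = 0`, AEC Ex. 3.7).
[cite: SerreInventiones1972, §1.11 Prop. 11] [cite: SilvermanAEC2009, III Ex. 3.7(d),(f)] -/
theorem exists_integral_zsmul_eq_zero_of_natDegree_map_residue_ne_zero {L : Type u} [Field L] [IsAlgClosed L]
    (O : ValuationSubring L) {M : WeierstrassCurve O} (hΔ : (M.baseChange L).Δ ≠ 0)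
    (p : ℕ) (hdeg : ((M.ΨSq p).map (IsLocalRing.residue O)).natDegree ≠ 0) :
    ∃ (a b : O) (h : (M.baseChange L).toAffine.Nonsingular (algebraMap O L a) (algebraMap O L b)),
      (p : ℤ) • (Affine.Point.some _ _ h : (M.baseChange L).toAffine.Point) = 0 := by
  have hinj : Function.Injective (algebraMap O L) := Subtype.val_injective
  obtain ⟨a, ha⟩ := exists_isRoot_of_natDegree_map_residue_ne_zero O _ hdeg
  -- an integral ordinate over `a`
  set c₁ : O := M.a₁ * a + M.a₃ with hc₁
  set c₀ : O := a ^ 3 + M.a₂ * a ^ 2 + M.a₄ * a + M.a₆ with hc₀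
  have hlt2 : (C c₁ * X - C c₀).degree < ((2 : ℕ) : WithBot ℕ) :=
    (degree_sub_le _ _).trans_lt
      (max_lt ((degree_C_mul_X_le _).trans_lt (by decide)) (degree_C_le.trans_lt (by decide)))
  have hqm : (X ^ 2 + (C c₁ * X - C c₀) : O[X]).Monic := monic_X_pow_add hlt2
  have hlt : (C c₁ * X - C c₀).degree < (X ^ 2 : O[X]).degree := by rwa [degree_X_pow]
  have hqnat : (X ^ 2 + (C c₁ * X - C c₀) : O[X]).natDegree = 2 := by
    rw [natDegree_add_eq_left_of_degree_lt hlt, natDegree_X_pow]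
  have hqdeg :
      ((X ^ 2 + (C c₁ * X - C c₀) : O[X]).map (IsLocalRing.residue O)).natDegree ≠ 0 := by
    rw [hqm.natDegree_map, hqnat]
    exact two_ne_zero
  obtain ⟨b, hb⟩ := exists_isRoot_of_natDegree_map_residue_ne_zero O _ hqdeg
  have hrootb : b ^ 2 + c₁ * b - c₀ = 0 := by
    have : b ^ 2 + (c₁ * b - c₀) = 0 := by
      have h := hb.eq_zero
      simpa only [eval_add, eval_sub, eval_pow, eval_mul, eval_X, eval_C] using h
    linear_combination this
  have hab : b ^ 2 + (M.a₁ * a + M.a₃) * b = a ^ 3 + M.a₂ * a ^ 2 + M.a₄ * a + M.a₆ := by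
    rw [hc₁, hc₀] at hrootb
    linear_combination hrootb
  -- the integral point `(a, b) ∈ M(L)[p]`
  have heqO : M.toAffine.Equation a b := by
    rw [WeierstrassCurve.Affine.equation_iff]
    linear_combination hab
  have heqK : (M.baseChange L).toAffine.Equation (algebraMap O L a) (algebraMap O L b) :=
    (map_equation_iff hinj).mpr heqO
  have hns : (M.baseChange L).toAffine.Nonsingular (algebraMap O L a) (algebraMap O L b) :=
    ((M.baseChange L).toAffine.equation_iff_nonsingular_of_Δ_ne_zero hΔ).mp heqK
  refine ⟨a, b, hns, ?_⟩
  rw [WeierstrassCurve.zsmul_some_eq_zero_iff_eval_ΨSq _ hns p]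
  change ((M.map (algebraMap O L)).ΨSq p).eval (algebraMap O L a) = 0
  rw [WeierstrassCurve.map_ΨSq, eval_map, eval₂_at_apply, ha.eq_zero, map_zero]

/-! ## §2 `ΨSq₃` in characteristic `3` -/

/-- In characteristic `3`, `Ψ₃ = b₂X³ + b₈`. [cite: SilvermanAEC2009, III Ex. 3.7 (ψ₃ = 3x⁴ + b₂x³ + 3b₄x² + 3b₆x + b₈)] -/
theorem Ψ₃_of_three_eq_zero {R : Type u} [CommRing R] (M : WeierstrassCurve R) (h3 : (3 : R) = 0) :
    M.Ψ₃ = C M.b₂ * X ^ 3 + C M.b₈ := by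
  have h3' : (3 : R[X]) = 0 := by rw [← map_ofNat (C : R →+* R[X]) 3, h3, map_zero]
  rw [Ψ₃, h3']
  ring

/-- **In characteristic `3` with `b₂ ≠ 0`, `ΨSq₃ = Ψ₃²` has positive degree** (degree `6`) over a domain.
[cite: SilvermanAEC2009, III Ex. 3.7] -/
theorem natDegree_ΨSq_three_ne_zero_of_b₂_ne_zero {R : Type u} [CommRing R] [IsDomain R] (M : WeierstrassCurve R)
    (h3 : (3 : R) = 0) (hb₂ : M.b₂ ≠ 0) : (M.ΨSq 3).natDegree ≠ 0 := by
  have hΨ : M.Ψ₃ = C M.b₂ * X ^ 3 + C M.b₈ := M.Ψ₃_of_three_eq_zero h3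
  have hdeg3 : M.Ψ₃.natDegree = 3 := by
    rw [hΨ]
    have h1 : (C M.b₂ * X ^ 3 : R[X]).natDegree = 3 := natDegree_C_mul_X_pow 3 M.b₂ hb₂
    rw [natDegree_add_eq_left_of_natDegree_lt] <;> rw [h1]
    exact (natDegree_C _).trans_lt (by norm_num)
  have hsq : M.ΨSq 3 = M.Ψ₃ ^ 2 := by
    rw [show (3 : ℤ) = ((3 : ℕ) : ℤ) by rfl, ΨSq_ofNat, preΨ'_three, if_neg (by decide), mul_one]
  rw [hsq, natDegree_pow, hdeg3]
  norm_num

/-! ## §3 The ordinary point at a place `v ∋ 3` of multiplicative reduction -/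

section NumberField

variable {K : Type u} [Field K] [NumberField K] (W : WeierstrassCurve K) [W.IsElliptic]
  (v : HeightOneSpectrum (𝓞 K))

omit [W.IsElliptic] in
/-- **`b₂(Ẽ_v) ≠ 0` at a place `v ∋ 3` of multiplicative reduction**: the reduced minimal model is nodal (`c₄(Ẽ_v) ≠ 0`,
Silverman AEC VII.5.1(b)) and `c₄ = b₂² − 24b₄ = b₂²` in characteristic `3`. [cite: SilvermanAEC2009, VII.5 Prop. 5.1(b)] -/
theorem reductionAt_b₂_ne_zero_of_hasMultiplicativeReductionAt_three (h3v : ((3 : ℕ) : 𝓞 K) ∈ v.asIdeal)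
    (hmult : W.HasMultiplicativeReductionAt v) : (W.reductionAt v).b₂ ≠ 0 := by
  obtain ⟨-, hc₄⟩ := (hasMultiplicativeReductionAt_iff_mem v W).mp hmult
  have hc₄' : (W.reductionAt v).c₄ ≠ 0 := by
    rw [reductionAt_eq_map_residue, map_c₄]
    exact fun h0 ↦ hc₄ ((IsLocalRing.residue_eq_zero_iff _).mp h0)
  haveI : CharP (IsLocalRing.ResidueField (v.adicCompletionIntegers K)) 3 :=
    ringChar.of_eq (ringChar_residueField_eq v Nat.prime_three h3v)
  have h24 : (24 : IsLocalRing.ResidueField (v.adicCompletionIntegers K)) = 0 := by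
    have h : ((24 : ℕ) : IsLocalRing.ResidueField (v.adicCompletionIntegers K)) = 0 := by
      rw [CharP.cast_eq_zero_iff _ 3]; norm_num
    exact_mod_cast h
  intro hb₂
  apply hc₄'
  rw [WeierstrassCurve.c₄, hb₂, h24]
  ring

/-- **The ordinary point at a multiplicative `v ∋ 3`**: some `3`-torsion point of `E(K̄_v)` lies outside the kernel of reduction
`E₁(K̄_v)` — an integral `3`-torsion point of the minimal model, from `ψ₃ ≡ b₂x³ + b₈ (mod 𝔪_v)` non-constant (for the Tate curve:
`q^{1/3}`). [cite: SerreInventiones1972, §1.11 Prop. 11] [cite: SilvermanAEC2009, III Ex. 3.7 and VII.2.1]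
[cite: SilvermanATAEC1994, V.3 (E[p] ∩ E₁ = μ_p for the Tate curve)] -/
theorem exists_ordinaryPoint_local_of_hasMultiplicativeReductionAt_three (h3v : ((3 : ℕ) : 𝓞 K) ∈ v.asIdeal)
    (hmult : W.HasMultiplicativeReductionAt v) :
    ∃ P : localPoints W (v.adicCompletion K), ((3 : ℕ) : ℤ) • P = 0 ∧ P ∉ W.localKernelOfReduction v := by
  set L := AlgebraicClosure (v.adicCompletion K)
  let O : ValuationSubring L := (v.spectralValuation).valuationSubring
  haveI hkv : CharP (IsLocalRing.ResidueField (v.adicCompletionIntegers K)) 3 :=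
    ringChar.of_eq (ringChar_residueField_eq v Nat.prime_three h3v)
  have h3k : (3 : IsLocalRing.ResidueField (v.adicCompletionIntegers K)) = 0 := by
    exact_mod_cast CharP.cast_eq_zero (IsLocalRing.ResidueField (v.adicCompletionIntegers K)) 3
  -- `ΨSq₃` of the reduction is non-constant, on `Ẽ_v` and then on the spectral model
  have hdegE : ((W.reductionAt v).ΨSq 3).natDegree ≠ 0 :=
    natDegree_ΨSq_three_ne_zero_of_b₂_ne_zero _ h3k
      (W.reductionAt_b₂_ne_zero_of_hasMultiplicativeReductionAt_three v h3v hmult)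
  have hdegO : (((show WeierstrassCurve O from W.localSpectralModel v).ΨSq 3).map
      (IsLocalRing.residue O)).natDegree ≠ 0 := by
    have h : (((W.localSpectralModel v).ΨSq 3).map
        (IsLocalRing.residue (v.spectralValuation).integer)).natDegree ≠ 0 := by
      rw [localSpectralModel, WeierstrassCurve.map_ΨSq]
      refine natDegree_map_map_residue_ne_zero (v.toSpectralInteger) _ ?_
      rwa [reductionAt_eq_map_residue, WeierstrassCurve.map_ΨSq] at hdegE
    exact h
  -- the generic fibre of the spectral model is elliptic
  have hΔL : ((show WeierstrassCurve O from W.localSpectralModel v).baseChange L).Δ ≠ 0 := by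
    have h1 : ((W.localSpectralModel v).baseChange L).Δ ≠ 0 := by
      rw [localSpectralModel_baseChange, ← smul_baseChange_eq_map_localMinimalIntegralModel]
      haveI := W.isElliptic_localMinimalModel v
      change ((W.localMinimalModel v).baseChange L).Δ ≠ 0
      exact (WeierstrassCurve.isUnit_Δ _).ne_zero
    exact h1
  obtain ⟨a, b, hns, hp3⟩ :=
    exists_integral_zsmul_eq_zero_of_natDegree_map_residue_ne_zero O hΔL 3 hdegO
  -- read back on `E(K̄_v)`
  set T := W.localPointsEquivSpectralModel v
  refine ⟨T.symm (.some _ _ hns), ?_, fun hmem ↦ ?_⟩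
  · apply T.injective
    rw [map_zsmul, AddEquiv.apply_symm_apply, map_zero]
    exact hp3
  · have h := (W.mem_localKernelOfReduction_iff v _).mp hmem
    rw [AddEquiv.apply_symm_apply] at h
    exact (reducesToZero_some_iff hns).mp h ⟨a, rfl⟩

/-- **The ordinary point on `E(K̄)`**: at a multiplicative `v ∋ 3` some `3`-torsion point of `E(K̄)` lies outside
`Fil_v E[3] = torsionFilAt W v 3` (every `3`-torsion point of `E(K̄_v)` comes from `E(K̄)[3]`). [cite: GreenbergLNM1716, §1 p. 62]
[cite: SilvermanATAEC1994, V.3] -/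
theorem exists_not_mem_torsionFilAt_of_hasMultiplicativeReductionAt_three (h3v : ((3 : ℕ) : 𝓞 K) ∈ v.asIdeal)
    (hmult : W.HasMultiplicativeReductionAt v) :
    ∃ P : geomTorsion W ((3 : ℕ) : ℤ), P ∉ W.torsionFilAt v ((3 : ℕ) : ℤ) := by
  haveI : Fact (Nat.Prime 3) := ⟨Nat.prime_three⟩
  obtain ⟨P, h3P, hP⟩ := W.exists_ordinaryPoint_local_of_hasMultiplicativeReductionAt_three v h3v hmult
  obtain ⟨Q, hQ3, hQP⟩ := W.exists_geomTorsion_pointsMapOfEmb_eq v (p := 3) 1 P (by rwa [pow_one])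
  refine ⟨⟨Q, (mem_geomTorsion_iff W _ _).mpr (by rwa [pow_one] at hQ3)⟩, fun hmem ↦ hP ?_⟩
  rw [mem_torsionFilAt_iff] at hmem
  rwa [hQP] at hmem

/-! ## §4 Consequences: the Tate line `Fil_v E[3^k]` is cyclic and isotropic at a multiplicative `v ∋ 3` -/

/-- **`Fil_v E[3^k]` is cyclic at a place `v ∋ 3` of multiplicative reduction** (the Tate line `μ_{3^k} ⊂ E[3^k]`), in the binder
shape of x9's `exists_generator_torsionFilAt`: the ordinary point of §3 fed to `exists_generator_torsionFilAt_of_exists_not_mem`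
(`TorsionFilAtCyclicOfOrdinaryPointProofs`). [cite: SilvermanATAEC1994, V.3 (Tate curve: E[p^k] ∩ E₁ = μ_{p^k})]
[cite: Howard2004HeegnerKolyvagin, §3.1 (arXiv p. 15, L56–62: Fil_v T has rank one)] -/
theorem exists_generator_torsionFilAt_of_hasMultiplicativeReductionAt_three (h3v : ((3 : ℕ) : 𝓞 K) ∈ v.asIdeal)
    (hmult : W.HasMultiplicativeReductionAt v) (k : ℕ) :
    ∃ P₀ ∈ W.torsionFilAt v (((3 : ℕ) : ℤ) ^ k), ∀ P ∈ W.torsionFilAt v (((3 : ℕ) : ℤ) ^ k), ∃ c : ℤ, P = c • P₀ := by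
  haveI : Fact (Nat.Prime 3) := ⟨Nat.prime_three⟩
  exact W.exists_generator_torsionFilAt_of_exists_not_mem v
    (W.exists_not_mem_torsionFilAt_of_hasMultiplicativeReductionAt_three v h3v hmult) k

/-- **`Fil_v E[3^k]` is isotropic for every bi-additive `e` on `E[3^k]` with `e(a, a) = 0`** (the Weil pairing) at a place `v ∋ 3` of
multiplicative reduction — the `E`-level input of the isotropy of the Tate-line condition in Howard's H.4 at `v ∣ 3` (Lemma 3.1.1), for
the twin of crux 24737. [cite: Howard2004HeegnerKolyvagin, Lemma 3.1.1 (arXiv p. 15, L60–62)] [cite: SilvermanAEC2009, Prop. III.8.1] -/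
theorem pairing_torsionFilAt_eq_zero_of_hasMultiplicativeReductionAt_three {P : Type v} [AddCommGroup P]
    (h3v : ((3 : ℕ) : 𝓞 K) ∈ v.asIdeal) (hmult : W.HasMultiplicativeReductionAt v) (k : ℕ)
    (e : geomTorsion W (((3 : ℕ) : ℤ) ^ k) →+ geomTorsion W (((3 : ℕ) : ℤ) ^ k) →+ P) (hself : ∀ a, e a a = 0) :
    ∀ a ∈ W.torsionFilAt v (((3 : ℕ) : ℤ) ^ k), ∀ b ∈ W.torsionFilAt v (((3 : ℕ) : ℤ) ^ k), e a b = 0 := by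
  haveI : Fact (Nat.Prime 3) := ⟨Nat.prime_three⟩
  exact W.pairing_torsionFilAt_eq_zero_of_exists_not_mem v
    (W.exists_not_mem_torsionFilAt_of_hasMultiplicativeReductionAt_three v h3v hmult) k e hself

end NumberField

end WeierstrassCurve

end
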